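import Literature.Geometry.Lorentzian.SpacetimeLocalConvergenceTimeOrientation
import HarnessLib

/-!
# Normalising a pointed `Cᵏ_loc` convergence datum to TIMELIKE images of the orienting field
(topic `Geometry/Lorentzian`; `Spacetime.LocalSubconvergence`, Petersen 2006, Ch. 10, §3.2;
O'Neill 1983, Ch. 5, p. 145)

A datum `D : (𝓢ₙ, pₙ) ⇀ (𝓣, t)` only asks its comparison maps `φₙ` to send the orienting field `T`
of the limit to future-directed (causal) vectors on `U n`. Along the convergence the images become
TIMELIKE on every compact set for large `n` (`eventually_isTimelike_mfderiv_embed`, a margin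
argument), so after re-indexing the comparison maps — keep the exhaustion `U`, use `φ_{ρ m}` on
`U m` for a strictly increasing `ρ` with `ρ m ≥ m` — one obtains a datum of the SAME convergence
whose comparison maps send `T` to future-directed TIMELIKE vectors on the closure of every `U m`
(`LocalSubconvergence.timelikeNormalize`, `isTimelike_mfderiv_timelikeNormalize`). Consumers of
`SubconvergesLocallyTo` may therefore assume timelike images at no cost
(`SubconvergesLocallyTo.exists_timelike`).

## References
* [Petersen2006] P. Petersen, *Riemannian Geometry*, 2nd ed., GTM 171, Springer 2006, Ch. 10, §3.2.
* [ONeill1983] B. O'Neill, *Semi-Riemannian Geometry*, Academic Press 1983, Ch. 5, p. 145.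
-/

noncomputable section

open TopologicalSpace Manifold Filter Topology Set Function
open scoped ContDiff Topology

universe u v

namespace Literature.Geometry.Lorentzian

namespace Spacetime

namespace LocalSubconvergence

variable {𝓢ₙ : ℕ → Spacetime.{u} 4} {pₙ : ∀ n, (𝓢ₙ n).carrier} {𝓣 : Spacetime.{v} 4}
  {t : 𝓣.carrier} {k : ℕ}

/-- **Re-indexing the comparison maps over a FIXED exhaustion**: for a strictly increasing `ρ`
(so `m ≤ ρ m` and `U m ⊆ U (ρ m)`), the maps `φ_{ρ m}` restricted to `U m` form a datum of the same
convergence. (Compare `subseq`, which also re-indexes the exhaustion.) [folklore] -/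
def reindex (D : LocalSubconvergence 𝓢ₙ pₙ 𝓣 t k) (ρ : ℕ → ℕ) (hρ : StrictMono ρ) :
    LocalSubconvergence 𝓢ₙ pₙ 𝓣 t k where
  sub := D.sub ∘ ρ
  strictMono_sub := D.strictMono_sub.comp hρ
  U := D.U
  monotone_U := D.monotone_U
  mem_U := D.mem_U
  iUnion_U := D.iUnion_U
  isCompact_closure_U := D.isCompact_closure_U
  embed m := D.embed (ρ m)
  isLocalDiffeomorphOn_embed m x :=
    D.isLocalDiffeomorphOn_embed (ρ m) ⟨x, D.monotone_U (hρ.id_le m) x.2⟩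
  injOn_embed m := (D.injOn_embed (ρ m)).mono (D.monotone_U (hρ.id_le m))
  embed_basepoint m := D.embed_basepoint (ρ m)
  isFutureDirected_mfderiv_embed m x hx :=
    D.isFutureDirected_mfderiv_embed (ρ m) x (D.monotone_U (hρ.id_le m) hx)
  tendsto_supCkENorm x K hK hKt := (D.tendsto_supCkENorm x K hK hKt).comp hρ.tendsto_atTop

/-- The comparison maps of the re-indexed datum. [folklore] -/
@[simp]
theorem reindex_embed (D : LocalSubconvergence 𝓢ₙ pₙ 𝓣 t k) (ρ : ℕ → ℕ) (hρ : StrictMono ρ)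
    (m : ℕ) : (D.reindex ρ hρ).embed m = D.embed (ρ m) := rfl

/-- The subsequence of the re-indexed datum. [folklore] -/
@[simp]
theorem reindex_sub (D : LocalSubconvergence 𝓢ₙ pₙ 𝓣 t k) (ρ : ℕ → ℕ) (hρ : StrictMono ρ)
    (m : ℕ) : (D.reindex ρ hρ).sub m = D.sub (ρ m) := rfl

/-- The exhaustion of the re-indexed datum is the original one. [folklore] -/
@[simp]
theorem reindex_U (D : LocalSubconvergence 𝓢ₙ pₙ 𝓣 t k) (ρ : ℕ → ℕ) (hρ : StrictMono ρ) :
    (D.reindex ρ hρ).U = D.U := rfl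

/-- Existence of a **timelike re-indexing**: a strictly increasing `ρ` such that `dφ_{ρ m}` sends
the orienting field to TIMELIKE vectors on the closure of `U m`, for every `m`. [cite: ONeill1983, Ch. 5, p. 145] -/
theorem exists_timelikeIndex (D : LocalSubconvergence 𝓢ₙ pₙ 𝓣 t k) :
    ∃ ρ : ℕ → ℕ, StrictMono ρ ∧ ∀ m, ∀ x ∈ closure (D.U m : Set 𝓣.carrier),
      (𝓢ₙ (D.sub (ρ m))).metric.IsTimelike
        (mfderiv (𝓡 4) (𝓡 4) (D.embed (ρ m)) x (𝓣.timeOrientation.vectorField x)) :=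
  extraction_forall_of_eventually fun m ↦
    D.eventually_isTimelike_mfderiv_embed (D.isCompact_closure_U m)

/-- A timelike re-indexing (a choice). [folklore] -/
def timelikeIndex (D : LocalSubconvergence 𝓢ₙ pₙ 𝓣 t k) : ℕ → ℕ :=
  Classical.choose D.exists_timelikeIndex

/-- The timelike re-indexing is strictly increasing. [folklore] -/
theorem strictMono_timelikeIndex (D : LocalSubconvergence 𝓢ₙ pₙ 𝓣 t k) :
    StrictMono D.timelikeIndex :=
  (Classical.choose_spec D.exists_timelikeIndex).1

/-- The defining property of the timelike re-indexing. [folklore] -/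
theorem isTimelike_mfderiv_embed_timelikeIndex (D : LocalSubconvergence 𝓢ₙ pₙ 𝓣 t k) (m : ℕ)
    {x : 𝓣.carrier} (hx : x ∈ closure (D.U m : Set 𝓣.carrier)) :
    (𝓢ₙ (D.sub (D.timelikeIndex m))).metric.IsTimelike
      (mfderiv (𝓡 4) (𝓡 4) (D.embed (D.timelikeIndex m)) x (𝓣.timeOrientation.vectorField x)) :=
  (Classical.choose_spec D.exists_timelikeIndex).2 m x hx

/-- **The timelike normalisation** of a datum: same exhaustion, comparison maps `φ_{ρ m}` for the
timelike re-indexing `ρ`. [cite: Petersen2006, Ch. 10 §3.2] -/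
def timelikeNormalize (D : LocalSubconvergence 𝓢ₙ pₙ 𝓣 t k) : LocalSubconvergence 𝓢ₙ pₙ 𝓣 t k :=
  D.reindex D.timelikeIndex D.strictMono_timelikeIndex

/-- **Timelike images after normalisation**: the comparison maps of `D.timelikeNormalize` send
the orienting field of the limit to TIMELIKE vectors on the closure of every `U m`. [cite: ONeill1983, Ch. 5, p. 145] -/
theorem isTimelike_mfderiv_timelikeNormalize (D : LocalSubconvergence 𝓢ₙ pₙ 𝓣 t k) (m : ℕ)
    {x : 𝓣.carrier} (hx : x ∈ closure (D.timelikeNormalize.U m : Set 𝓣.carrier)) :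
    (𝓢ₙ (D.timelikeNormalize.sub m)).metric.IsTimelike
      (mfderiv (𝓡 4) (𝓡 4) (D.timelikeNormalize.embed m) x
        (𝓣.timeOrientation.vectorField x)) :=
  D.isTimelike_mfderiv_embed_timelikeIndex m hx

/-- After normalisation the images of the orienting field on `U m` are future-directed AND
timelike. [cite: ONeill1983, Ch. 5, p. 145] -/
theorem isFutureDirected_and_isTimelike_timelikeNormalize (D : LocalSubconvergence 𝓢ₙ pₙ 𝓣 t k)
    (m : ℕ) {x : 𝓣.carrier} (hx : x ∈ D.timelikeNormalize.U m) :
    (𝓢ₙ (D.timelikeNormalize.sub m)).timeOrientation.IsFutureDirected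
        (mfderiv (𝓡 4) (𝓡 4) (D.timelikeNormalize.embed m) x
          (𝓣.timeOrientation.vectorField x)) ∧
      (𝓢ₙ (D.timelikeNormalize.sub m)).metric.IsTimelike
        (mfderiv (𝓡 4) (𝓡 4) (D.timelikeNormalize.embed m) x
          (𝓣.timeOrientation.vectorField x)) :=
  ⟨D.timelikeNormalize.isFutureDirected_mfderiv_embed m x hx,
    D.isTimelike_mfderiv_timelikeNormalize m (subset_closure hx)⟩

end LocalSubconvergence

/-- **Timelike images at no cost** (`Prop` level): every pointed `Cᵏ_loc` subconvergence admits a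
datum whose comparison maps send the orienting field of the limit to future-directed TIMELIKE
vectors on (the closure of) every set of its exhaustion. [cite: Petersen2006, Ch. 10 §3.2] -/
theorem SubconvergesLocallyTo.exists_timelike {𝓢ₙ : ℕ → Spacetime.{u} 4}
    {pₙ : ∀ n, (𝓢ₙ n).carrier} {𝓣 : Spacetime.{v} 4} {t : 𝓣.carrier} {k : ℕ}
    (h : SubconvergesLocallyTo 𝓢ₙ pₙ 𝓣 t k) :
    ∃ D : LocalSubconvergence 𝓢ₙ pₙ 𝓣 t k, ∀ m, ∀ x ∈ closure (D.U m : Set 𝓣.carrier),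
      (𝓢ₙ (D.sub m)).metric.IsTimelike
        (mfderiv (𝓡 4) (𝓡 4) (D.embed m) x (𝓣.timeOrientation.vectorField x)) := by
  obtain ⟨D⟩ := h
  exact ⟨D.timelikeNormalize, fun m _ hx ↦ D.isTimelike_mfderiv_timelikeNormalize m hx⟩

end Spacetime

end Literature.Geometry.Lorentzian
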